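import Summits.HodgeConjecture.HodgeConjecture.Theorems.MarkmanPartnerTransportPicardThreeK3SquaresSquareOfGenerator
import Literature.AlgebraicGeometry.HodgeTheory.AlgebraicityLocusIUnionClosedProofs
import Literature.AlgebraicGeometry.HodgeTheory.HodgeGenericQbarDescentCompactification
import Literature.AlgebraicGeometry.HodgeTheory.AlgebraicClassesPullback
import Literature.AlgebraicGeometry.Motives.VeryGeneralComplexPoint

/-!
# Route MarkmanPartnerTransport · crux `PicardThreeK3Squares` (stmt-HodgeConjecture-19652) —
# stub F3 `AlgebraicLocusClosed` of line `cm-anchor-spread`, PROVED, and the spread-family reduction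
# of the real-multiplication third

The line `cm-anchor-spread` (planner p1 g9; registered skeleton r2, lead g0) isolates as stub F3
`AlgebraicLocusClosed` the SPREADING step of every variational attack on the crux: *for a smooth
projective family `𝒳 → B` with quasi-projective total space over a smooth quasi-projective base with
`B(ℂ)` connected and a global class `W`, if `W|_{𝒳_b}` is algebraic for all `b` in a non-empty
Euclidean-open `U ⊆ B(ℂ)` then it is algebraic for every `b`*. The line card sized it "L–XL (relative
Hilbert schemes are not in the tree)". It is PROVED here, fact-free, from three theorems of the tree:
the structure theorem of algebraicity loci `charlesSchnell_algebraicityLocus_iUnion_closed_holds`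
(Charles–Schnell Prop. 11.3.11 / Voisin II §3.3.1: the locus is `⋃ⱼ Wⱼ(ℂ)` for countably many
Zariski-closed `Wⱼ ⊆ B`), the Baire device `ComplexPoints.exists_mem_forall_pt_not_mem` (a non-empty
analytic open set of `B(ℂ)` contains a point off countably many proper closed subsets of the irreducible
`B`) and `irreducibleSpace_left_of_connectedSpace_complexPoints` (smooth + `B(ℂ)` connected ⟹ `B`
irreducible: SGA1 XII 2.4 + Stacks 056S).

* `forall_mem_algebraicClasses_of_isOpen` — spread from a non-empty open set, irreducible base;
* `forall_mem_algebraicClasses_of_denseRange` — spread ALONG A DOMINANT MORPHISM `c : V → B` from an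
  irreducible `V`: if `W` is algebraic on the fibres over `c(v)` for every `v ∈ V(ℂ)` and `c` has dense
  image, it is algebraic on every fibre (Baire on `V(ℂ)`: the closed `c⁻¹Wⱼ` cannot all be proper) —
  the shape in which a positive-dimensional ALGEBRAIC family of cycles (e.g. a maximal family of K3
  surfaces with cycle-induced real multiplication, van Geemen–Schütt 2025 Thm. 1.1 (9), Thm. 1.2 (2),
  mapped to the real-multiplication locus by its classifying morphism) feeds the spread, with no
  semiregularity and no CM anchor;
* `algebraicLocusClosed` — **stub F3 LITERALLY** (hypothesis `ConnectedSpace (ComplexPoints B)`);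
* `hodgeConjectureFor_square_of_spreadFamily`, `hodgeConjectureFor_square_of_dominantFamily` — the
  COMPOSITION F3 ∘ F4 for one surface: if `S × S` is a fibre of such a family carrying a global class
  `W` which is algebraic on the fibres over a non-empty open set (resp. over the image of a dominant
  `c`), and `W|_{S × S}` induces a rational endomorphism `t` of `H²(S)` killing `N¹` and generating the
  rational Hodge endomorphisms of `T(S)` (`TranscendentalEndomorphismsGeneratedBy`), then the Hodge
  conjecture holds for `S ⊗ S` (`t` is then cycle-induced on `S × S`, and the tree's rung F4
  `SquareOfGenerator.squareOfGenerator` concludes). This is the exact shape of the one remaining input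
  of a spread line for the real-multiplication third of the crux: a family through `S × S` over the
  real-multiplication Noether–Lefschetz locus with the generator class global (universal family + global
  invariant cycles) and algebraic along a dominating subfamily.

No definition, no sorry, no named fact. Prover seat hodge-nonav-19652-p1 (gen 7),
`--supports stmt-HodgeConjecture-19652`. Nothing here proves the crux or the Hodge conjecture.

References: Charles–Schnell, *Notes on absolute Hodge classes* (2014), Prop. 11.3.11; Voisin, *Hodge
Theory II* (2003), §3.3.1, §7.3.2; van Geemen–Schütt, Forum Math. Sigma 13 (2025) e2, §3, Thm. 1.1,
Thm. 1.2, §4.8; Varesco, Math. Z. 305 (2023), §2.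
-/

set_option linter.dupNamespace false

noncomputable section

namespace Summit.HodgeConjecture.HodgeConjecture.Theorems.MarkmanPartnerTransport.AlgebraicLocusSpread

open CategoryTheory MonoidalCategory CartesianMonoidalCategory AlgebraicGeometry
open Literature.AlgebraicGeometry Literature.AlgebraicGeometry.Motives Literature.AlgebraicGeometry.HodgeTheory
open Literature.AlgebraicGeometry.Surfaces
open Literature.AlgebraicTopology.SingularHomology

variable {𝒳 B : SchemeOver ℂ}

/-! ### Spreading algebraicity over an irreducible base -/

/-- **Open-to-everywhere spread of algebraicity** (Voisin II §7.3.2 "if `f ∈ B` is general and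
`f ∈ p_i(H_i)` then `p_i(H_i) = B`"): for a smooth projective family `g : 𝒳 → B` with quasi-projective
total space over a smooth irreducible quasi-projective base and a global class `W ∈ H²ᵖ(𝒳(ℂ); ℂ)`, if
`W|_{𝒳_b}` is algebraic for every `b` in a non-empty open `U ⊆ B(ℂ)` (analytic topology) then it is
algebraic for every `b ∈ B(ℂ)`: the algebraicity locus is `⋃ⱼ Wⱼ(ℂ)` with `Wⱼ ⊆ B` Zariski closed
(`charlesSchnell_algebraicityLocus_iUnion_closed_holds`); if some fibre class were not algebraic every
`Wⱼ` would be proper, and a point of `U` off all of them (`ComplexPoints.exists_mem_forall_pt_not_mem`,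
Baire) would contradict `U ⊆ ⋃ⱼ Wⱼ(ℂ)`.
[cite: CharlesSchnell2014Notes, Prop. 11.3.11 (proof)] [cite: VoisinHodgeII2003, §3.3.1 and §7.3.2] -/
theorem forall_mem_algebraicClasses_of_isOpen (g : 𝒳 ⟶ B) {n p : ℕ}
    (hg : IsSmoothProjectiveFamily g n) (h𝒳 : IsQuasiProjectiveOver 𝒳) (hB : IsQuasiProjectiveOver B)
    (hBsm : AlgebraicGeometry.Smooth B.hom) [IrreducibleSpace B.left] (W : complexBetti 𝒳 (2 * p))
    {U : Set (ComplexPoints B)} (hU : IsOpen U) (hUne : U.Nonempty)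
    (hUalg : ∀ b ∈ U, complexBetti.map (fiberι g b) (2 * p) W ∈ algebraicClasses (fiberOver g b) p)
    (b : ComplexPoints B) :
    complexBetti.map (fiberι g b) (2 * p) W ∈ algebraicClasses (fiberOver g b) p := by
  obtain ⟨Z, hZc, hloc⟩ := charlesSchnell_algebraicityLocus_iUnion_closed_holds g n p h𝒳 hB hBsm hg W
  haveI : LocallyOfFiniteType B.hom := locallyOfFiniteType_of_isQuasiProjectiveOver hB
  haveI : IsSeparated B.hom := by
    obtain ⟨P', j', hP', hj'⟩ := hB
    haveI : IsProper P'.hom := hP'.isProper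
    rw [show B.hom = j'.left ≫ P'.hom from (Over.w j').symm]
    infer_instance
  by_contra hb
  have hne : ∀ j, Z j ≠ Set.univ := by
    intro j hj
    apply hb
    have hmem : b ∈ ⋃ j, {t : ComplexPoints B | t.pt ∈ Z j} :=
      Set.mem_iUnion.2 ⟨j, by simp only [Set.mem_setOf_eq, hj, Set.mem_univ]⟩
    rw [← hloc] at hmem
    exact hmem
  obtain ⟨P, hPU, hP⟩ := ComplexPoints.exists_mem_forall_pt_not_mem (X := B) hZc hne hU hUne
  have hPmem : P ∈ {t : ComplexPoints B |
      complexBetti.map (fiberι g t) (2 * p) W ∈ algebraicClasses (fiberOver g t) p} := hUalg P hPU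
  rw [hloc] at hPmem
  obtain ⟨j, hj⟩ := Set.mem_iUnion.1 hPmem
  exact hP j hj

/-- **Spread of algebraicity along a dominant morphism** (the algebraic-family form of the Baire
argument): let `g : 𝒳 → B` be a smooth projective family with quasi-projective total space over a smooth
quasi-projective base, `W ∈ H²ᵖ(𝒳(ℂ); ℂ)` a global class, and `c : V → B` a morphism from an IRREDUCIBLE
separated `ℂ`-scheme `V` locally of finite type with DENSE image. If `W` is algebraic on the fibre over
`c(v)` for every complex point `v ∈ V(ℂ)`, then `W|_{𝒳_b}` is algebraic for every `b ∈ B(ℂ)`. Proof: the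
locus is `⋃ⱼ Wⱼ(ℂ)` (`charlesSchnell_algebraicityLocus_iUnion_closed_holds`); the Zariski-closed
`c⁻¹(Wⱼ) ⊆ V` cover `V(ℂ)`, so one of them is all of `V` (otherwise a very general complex point of
`V` lies in none, `ComplexPoints.exists_forall_pt_not_mem`), i.e. `c(V) ⊆ Wⱼ`, and `Wⱼ`, closed with
dense image inside, is `B`. No hypothesis on the dimension of `V` beyond dominance.
[cite: VoisinHodgeII2003, §3.3.1 and §7.3.2 (proof of Thm. 7.19)] [cite: CharlesSchnell2014Notes, Prop. 11.3.11] -/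
theorem forall_mem_algebraicClasses_of_denseRange (g : 𝒳 ⟶ B) {n p : ℕ}
    (hg : IsSmoothProjectiveFamily g n) (h𝒳 : IsQuasiProjectiveOver 𝒳) (hB : IsQuasiProjectiveOver B)
    (hBsm : AlgebraicGeometry.Smooth B.hom) (W : complexBetti 𝒳 (2 * p))
    {V : SchemeOver ℂ} (c : V ⟶ B) [IrreducibleSpace V.left] [IsSeparated V.hom]
    [LocallyOfFiniteType V.hom] [Nonempty (ComplexPoints V)] (hc : DenseRange c.left.base)
    (hValg : ∀ v : ComplexPoints V,
      complexBetti.map (fiberι g (AlgPoints.map c v)) (2 * p) W ∈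
        algebraicClasses (fiberOver g (AlgPoints.map c v)) p)
    (b : ComplexPoints B) :
    complexBetti.map (fiberι g b) (2 * p) W ∈ algebraicClasses (fiberOver g b) p := by
  obtain ⟨Z, hZc, hloc⟩ := charlesSchnell_algebraicityLocus_iUnion_closed_holds g n p h𝒳 hB hBsm hg W
  -- the closed preimages `c⁻¹(Z j) ⊆ V`
  have hpre_closed : ∀ j, IsClosed (c.left.base ⁻¹' Z j) := fun j =>
    (hZc j).preimage c.left.base.hom.continuous
  -- one of them is all of `V`
  have hcover : ∃ j, c.left.base ⁻¹' Z j = Set.univ := by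
    by_contra hnone
    push Not at hnone
    obtain ⟨P, hP⟩ := ComplexPoints.exists_forall_pt_not_mem (X := V) hpre_closed hnone
    have hPmem : AlgPoints.map c P ∈ {t : ComplexPoints B |
        complexBetti.map (fiberι g t) (2 * p) W ∈ algebraicClasses (fiberOver g t) p} := hValg P
    rw [hloc] at hPmem
    obtain ⟨j, hj⟩ := Set.mem_iUnion.1 hPmem
    refine hP j ?_
    simp only [Set.mem_preimage]
    simpa [AlgPoints.pt_map] using hj
  obtain ⟨j, hj⟩ := hcover
  -- hence `Z j ⊇ range c` is dense and closed: `Z j = univ`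
  have hrange : Set.range c.left.base ⊆ Z j := by
    rintro _ ⟨v, rfl⟩
    have : v ∈ c.left.base ⁻¹' Z j := by rw [hj]; exact Set.mem_univ v
    exact this
  have hZuniv : Z j = Set.univ := by
    apply Set.eq_univ_of_univ_subset
    calc Set.univ ⊆ closure (Set.range c.left.base) := by rw [hc.closure_range]
      _ ⊆ Z j := (hZc j).closure_subset_iff.2 hrange
  have hmem : b ∈ ⋃ j, {t : ComplexPoints B | t.pt ∈ Z j} :=
    Set.mem_iUnion.2 ⟨j, by simp only [Set.mem_setOf_eq, hZuniv, Set.mem_univ]⟩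
  rw [← hloc] at hmem
  exact hmem

/-! ### Stub F3 of line `cm-anchor-spread`, literally -/

/-- **Stub F3 `AlgebraicLocusClosed` of line `cm-anchor-spread` (crux `PicardThreeK3Squares`,
stmt-HodgeConjecture-19652), PROVED** — literally the registered body: for a smooth projective family
`g : 𝒳 → B` (quasi-projective total space, smooth quasi-projective base, `B(ℂ)` CONNECTED) and a
global class `W ∈ H²ᵖ(𝒳(ℂ); ℂ)`, algebraicity of `W|_{𝒳_b}` on a non-empty Euclidean-open `U ⊆ B(ℂ)`
implies algebraicity at every `b ∈ B(ℂ)`. A smooth `ℂ`-scheme with connected space of complex points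
is irreducible (`irreducibleSpace_left_of_connectedSpace_complexPoints`: SGA1 XII 2.4 and Stacks 056S),
so `forall_mem_algebraicClasses_of_isOpen` applies.
[cite: CharlesSchnell2014Notes, Prop. 11.3.11 (proof)] [cite: VoisinHodgeII2003, §3.3.1 and §7.3.2]
[cite: SGA1, Exp. XII Prop. 2.4] [cite: StacksProject, Tag 056S] -/
theorem algebraicLocusClosed :
    ∀ (𝒳 B : SchemeOver ℂ) (g : 𝒳 ⟶ B) (n p : ℕ) (W : complexBetti 𝒳 (2 * p)),
      IsSmoothProjectiveFamily g n → IsQuasiProjectiveOver 𝒳 → IsQuasiProjectiveOver B →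
      AlgebraicGeometry.Smooth B.hom → ConnectedSpace (ComplexPoints B) →
      ∀ U : Set (ComplexPoints B), IsOpen U → U.Nonempty →
        (∀ b ∈ U, complexBetti.map (Motives.fiberι g b) (2 * p) W ∈ algebraicClasses (fiberOver g b) p) →
        ∀ b : ComplexPoints B,
          complexBetti.map (Motives.fiberι g b) (2 * p) W ∈ algebraicClasses (fiberOver g b) p := by
  intro 𝒳 B g n p W hg h𝒳 hB hBsm hconn U hU hUne hUalg b
  haveI := hBsm
  haveI := hconn
  haveI : IrreducibleSpace B.left := irreducibleSpace_left_of_connectedSpace_complexPoints (Y := B)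
  exact forall_mem_algebraicClasses_of_isOpen g hg h𝒳 hB hBsm W hU hUne hUalg b

/-! ### The spread-family reduction of the real-multiplication third (F3 ∘ F4) -/

variable {S : SchemeOver ℂ}

/-- `Corr[hS ; γ, y] = pr₁_*(pr₂^* y ∪ γ)` on `H²(S(ℂ); ℂ)` for the complex orientation family — the
correspondence action of `γ ∈ H⁴((S ⊗ S)(ℂ); ℂ)`, in the spelling of `SquareOfGenerator.squareOfGenerator`
and of `IsCycleInducedTranscendentalEndomorphism`. Local notation only. -/
local notation3 (prettyPrint := false) "Corr[" hS " ; " γ ", " y "]" =>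
  complexGysin complexOrientationFamily (IsSmoothProjective.tensor_holds hS hS) hS
    (SemiCartesianMonoidalCategory.fst _ _) (rfl : 2 * 1 + 2 * 2 + 2 * 2 = 2 * 1 + 2 * (2 + 2))
    (cupProduct (rfl : 2 * 1 + 2 * 2 = 2 * 1 + 2 * 2)
      (complexBetti.map (SemiCartesianMonoidalCategory.snd _ _) (2 * 1) y) γ)

/-- **An endomorphism induced by the fibre value of a global class that is algebraic SOMEWHERE OPEN is
cycle-induced.** For a smooth projective surface `S` whose square `S ⊗ S ≅ 𝒳_{b₁}` is a fibre of a
smooth projective family `g : 𝒳 → B` (quasi-projective total space, smooth irreducible quasi-projective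
base) carrying a global class `W ∈ H⁴(𝒳(ℂ); ℂ)` algebraic on the fibres over a non-empty open
`U ⊆ B(ℂ)`: the endomorphism `t = [e₁^* W|_{𝒳_{b₁}}]_*` of `H²(S(ℂ); ℂ)` is induced by an ALGEBRAIC class
on `S × S` (spread `forall_mem_algebraicClasses_of_isOpen`, then transport along the isomorphism `e₁`,
`map_mem_algebraicClasses_of_isIso`). [cite: VoisinHodgeII2003, §7.3.2] [cite: CharlesSchnell2014Notes, Prop. 11.3.11] -/
theorem exists_algebraicClass_of_spreadFamily (hS : IsSmoothProjective 2 S)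
    (t : complexBetti S (2 * 1) →ₗ[ℂ] complexBetti S (2 * 1))
    (g : 𝒳 ⟶ B) {n : ℕ} (hg : IsSmoothProjectiveFamily g n) (h𝒳 : IsQuasiProjectiveOver 𝒳)
    (hB : IsQuasiProjectiveOver B) (hBsm : AlgebraicGeometry.Smooth B.hom) [IrreducibleSpace B.left]
    (W : complexBetti 𝒳 (2 * 2)) {U : Set (ComplexPoints B)} (hU : IsOpen U) (hUne : U.Nonempty)
    (hUalg : ∀ b ∈ U, complexBetti.map (fiberι g b) (2 * 2) W ∈ algebraicClasses (fiberOver g b) 2)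
    (b₁ : ComplexPoints B) (e₁ : S ⊗ S ≅ fiberOver g b₁)
    (ht : ∀ y : complexBetti S (2 * 1),
      t y = Corr[hS ; complexBetti.map e₁.hom (2 * 2) (complexBetti.map (fiberι g b₁) (2 * 2) W), y]) :
    ∃ γ ∈ algebraicClasses (S ⊗ S) 2, ∀ y : complexBetti S (2 * 1), t y = Corr[hS ; γ, y] := by
  refine ⟨complexBetti.map e₁.hom (2 * 2) (complexBetti.map (fiberι g b₁) (2 * 2) W), ?_, ht⟩
  exact map_mem_algebraicClasses_of_isIso e₁.hom
    (forall_mem_algebraicClasses_of_isOpen g hg h𝒳 hB hBsm W hU hUne hUalg b₁)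

/-- **The spread-family reduction of the real-multiplication third (F3 ∘ F4).** Let `S` be a smooth
projective surface and `t` a rational endomorphism of `H²(S(ℂ); ℂ)` killing `N = N¹H²` such that every
rational Hodge endomorphism killing `N` with image in `T = N^⊥` is a rational polynomial in `t` on `T`
(`TranscendentalEndomorphismsGeneratedBy S t` — for a K3 surface with real multiplication: `t` a
generator of `E = End_Hdg(T(S)_ℚ)`). Suppose `S × S ≅ 𝒳_{b₁}` is a fibre of a smooth projective family
`g : 𝒳 → B` (quasi-projective total space; smooth, irreducible, quasi-projective base) carrying a global
class `W ∈ H⁴(𝒳(ℂ); ℂ)` with `t = [e₁^* W|_{𝒳_{b₁}}]_*` and `W` ALGEBRAIC ON THE FIBRES OVER A NON-EMPTY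
OPEN SET of `B(ℂ)` (e.g. over the image of a dominating algebraic subfamily all of whose members carry
the class as an algebraic cycle). Then the Hodge conjecture holds for `S ⊗ S`: the class spreads to
`b₁` (`forall_mem_algebraicClasses_of_isOpen`), so `t` is cycle-induced, and the rung F4
`SquareOfGenerator.squareOfGenerator` (Varesco's bookkeeping over `ℚ[t]`) concludes. This is the whole
variational line for the RM third of the crux with its one geometric input — the family — as hypothesis;
no CM anchor, no semiregularity. [cite: Varesco2023, §2 (p. 8)] [cite: GeemenSchutt2023, §3 and §4.8]
[cite: VoisinHodgeII2003, §7.3.2] -/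
theorem hodgeConjectureFor_square_of_spreadFamily (hS : IsSmoothProjective 2 S)
    (t : complexBetti S (2 * 1) →ₗ[ℂ] complexBetti S (2 * 1))
    (ht_rat : ∀ y, IsRationalClass y → IsRationalClass (t y))
    (ht_N : ∀ d ∈ algebraicClasses S 1, t d = 0)
    (hgen : TranscendentalEndomorphismsGeneratedBy S t)
    (g : 𝒳 ⟶ B) {n : ℕ} (hg : IsSmoothProjectiveFamily g n) (h𝒳 : IsQuasiProjectiveOver 𝒳)
    (hB : IsQuasiProjectiveOver B) (hBsm : AlgebraicGeometry.Smooth B.hom) [IrreducibleSpace B.left]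
    (W : complexBetti 𝒳 (2 * 2)) {U : Set (ComplexPoints B)} (hU : IsOpen U) (hUne : U.Nonempty)
    (hUalg : ∀ b ∈ U, complexBetti.map (fiberι g b) (2 * 2) W ∈ algebraicClasses (fiberOver g b) 2)
    (b₁ : ComplexPoints B) (e₁ : S ⊗ S ≅ fiberOver g b₁)
    (ht : ∀ y : complexBetti S (2 * 1),
      t y = Corr[hS ; complexBetti.map e₁.hom (2 * 2) (complexBetti.map (fiberι g b₁) (2 * 2) W), y]) :
    HodgeConjectureFor 4 (S ⊗ S) :=
  SquareOfGenerator.squareOfGenerator S hS t ht_rat ht_N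
    (exists_algebraicClass_of_spreadFamily hS t g hg h𝒳 hB hBsm W hU hUne hUalg b₁ e₁ ht) hgen

/-- **Dominant-family form of the reduction.** As `hodgeConjectureFor_square_of_spreadFamily`, with the
open set replaced by a DOMINANT morphism `c : V → B` from an irreducible `V` such that `W` is algebraic on
the fibre over `c(v)` for every `v ∈ V(ℂ)` (`forall_mem_algebraicClasses_of_denseRange`) — the shape
supplied by an algebraic family of surfaces all carrying the generator as a cycle (van Geemen–Schütt
2025 §4.8: "the action of `ζₙ + ζₙ⁻¹` on `H²` is induced by the cycle `Γ₁ + Γ₋₁`") and DOMINATING the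
real-multiplication locus (their maximal families, §3), once that locus carries a family with the
generator class global. [cite: GeemenSchutt2023, §3, Thm. 1.1 (9), Thm. 1.2 (2) and §4.8]
[cite: Varesco2023, §2 (p. 8)] [cite: VoisinHodgeII2003, §7.3.2] -/
theorem hodgeConjectureFor_square_of_dominantFamily (hS : IsSmoothProjective 2 S)
    (t : complexBetti S (2 * 1) →ₗ[ℂ] complexBetti S (2 * 1))
    (ht_rat : ∀ y, IsRationalClass y → IsRationalClass (t y))
    (ht_N : ∀ d ∈ algebraicClasses S 1, t d = 0)
    (hgen : TranscendentalEndomorphismsGeneratedBy S t)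
    (g : 𝒳 ⟶ B) {n : ℕ} (hg : IsSmoothProjectiveFamily g n) (h𝒳 : IsQuasiProjectiveOver 𝒳)
    (hB : IsQuasiProjectiveOver B) (hBsm : AlgebraicGeometry.Smooth B.hom)
    (W : complexBetti 𝒳 (2 * 2)) {V : SchemeOver ℂ} (c : V ⟶ B) [IrreducibleSpace V.left]
    [IsSeparated V.hom] [LocallyOfFiniteType V.hom] [Nonempty (ComplexPoints V)]
    (hc : DenseRange c.left.base)
    (hValg : ∀ v : ComplexPoints V,
      complexBetti.map (fiberι g (AlgPoints.map c v)) (2 * 2) W ∈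
        algebraicClasses (fiberOver g (AlgPoints.map c v)) 2)
    (b₁ : ComplexPoints B) (e₁ : S ⊗ S ≅ fiberOver g b₁)
    (ht : ∀ y : complexBetti S (2 * 1),
      t y = Corr[hS ; complexBetti.map e₁.hom (2 * 2) (complexBetti.map (fiberι g b₁) (2 * 2) W), y]) :
    HodgeConjectureFor 4 (S ⊗ S) :=
  SquareOfGenerator.squareOfGenerator S hS t ht_rat ht_N
    ⟨complexBetti.map e₁.hom (2 * 2) (complexBetti.map (fiberι g b₁) (2 * 2) W),
      map_mem_algebraicClasses_of_isIso e₁.hom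
        (forall_mem_algebraicClasses_of_denseRange g hg h𝒳 hB hBsm W c hc hValg b₁), ht⟩ hgen

end Summit.HodgeConjecture.HodgeConjecture.Theorems.MarkmanPartnerTransport.AlgebraicLocusSpread
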